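import Mathlib.Analysis.Normed.Module.Basic
import Mathlib.Analysis.Normed.Operator.ContinuousLinearMap
import Mathlib.Topology.Algebra.Module.Basic
import Mathlib.Tactic.Module
import Mathlib.Tactic.LinearCombination
import HarnessLib

/-!
# A twistor sphere is determined by any two non-proportional points (Buskin–Izadi, Lemma 1.1 — PROVED in arXiv v1,
# proof replaced by "an exercise that we leave to the reader" in v2), at the level of operators on `V_ℝ`

Topic `Literature/Geometry/Hyperkaehler`, namespace `Literature.Geometry.Hyperkaehler.TwistorSphere`. Written by the literature
seat `lit-w-verbitsky` (gen 14) of the cell `pub-hsemireg` (HodgeConjecture venture), 2026-08-25, as a kernel leg of rows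
V-V8 / V-V13 of that cell's Verbitsky table (twistor spheres `S(I, J)` in the period domain of complex tori; the notation
`S(I₁, I₂)` for non-anticommuting pairs used throughout [BI20] §3–§5 rests on this lemma). THEOREMS ONLY (no definition, no
named fact, no `sorry`). Nothing in this file is a statement about the Hodge conjecture.

## Source, verbatim (arXiv v2 numbering; "v2 p.N Lm" = PDF page N, text-layer line m of arXiv:1806.07831v2)

N. Buskin, E. Izadi, *Twistor lines in the period domain of complex tori*, arXiv:1806.07831v2 = Geom. Dedicata 213 (2021)
21–47 (journal pages unseen by the cell), §1.1, v2 p.5 L36–44: "Assume that `J : V_ℝ → V_ℝ` is a complex structure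
anticommuting with `I`. Then `I` and `J` determine a twistor sphere `S(I, J) := {aI + bJ + cK | a² + b² + c² = 1}`, where
`K = IJ`. In general, for two complex structures `I₁, I₂`, not necessarily anticommuting, such that `I₁ ≠ ±I₂`, and such
that they are contained in the same twistor sphere `S`, we will also denote this sphere by `S(I₁, I₂)`. Our notation is
justifed by the following lemma, whose proof is an exercise that we leave to the reader. **Lemma 1.1.** Every twistor
sphere `S` is uniquely determined by any pair of non-proportional complex structures `I₁, I₂ ∈ S`." ("justifed" [sic] in
both versions.) arXiv v1 (= the corpus text `paper:arxiv-1806.07831`, chunk p0005 L18–48; v1 PDF p.3–4) has the same Lemma 1.1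
with the same number, writes the sphere as `S(I,J,K)`, ends the preceding sentence at "justifed by the following lemma." and
— unlike v2 — PRINTS A PROOF (chunk p0005 L31–48 = v1 PDF p.4 L9–30), which this file follows: "Let the 3-dimensional real
vector space `⟨I,J,K⟩_ℝ ⊂ End V_ℝ` be equipped with the inner product `(·,·)` defined by requiring the basis `I,J,K` to be
orthonormal. Let `ℍ := ℍ(I,J) = ⟨Id, I,J,K⟩_ℝ ⊂ End V_ℝ` … For arbitrary vectors `u,v ∈ ⟨I,J,K⟩_ℝ ⊂ ℍ` we have the
equality in `ℍ`, `u·v = −(u,v)Id + u × v` where `·` denotes the product in `ℍ` and `u × v` is the ordinary cross product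
… Note that `u` and `v` are orthogonal if and only if `u` and `v` anticommute, and the vectors of length 1 in `⟨I,J,K⟩_ℝ`
are precisely those belonging to `S`. So our inner product does not depend on the choice of the quaternionic basis `I,J,K`
spanning the sphere `S`. […] Choose `u,v ∈ S` to be an orthonormal basis of our plane `⟨I₁,I₂⟩_ℝ` or, equivalently, a
pair of anticommuting complex structures in `S¹`. Then `u·v = u × v` is again a point in `S` whose corresponding vector is
orthogonal to our 2-plane … Thus `S = {au + bv + c u·v | a² + b² + c² = 1}` which shows that the set `S` is uniquely
determined by `u,v` (and `u·v`) and hence it is uniquely determined by `I₁` and `I₂`. □"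

## What is formalised (`F` = `V_ℝ`, a real normed space, `≠ 0` where said; `I, J` and `I', J'` two anticommuting pairs of
## complex structures, `K = IJ`, `K' = I'J'`; a point of `S(I, J)` is an operator `aI + bJ + cK`, `a² + b² + c² = 1`)

arXiv v1's printed proof, step by step, with ONE deviation said plainly: instead of orthonormalising the plane `⟨I₁, I₂⟩_ℝ`
(v1's `u, v`), the file expands in the orthogonal frame `(u₁, w, u₁ × w)`, `w = u₁ × u₂`, with the denominators `|w|²`
kept explicit (`expand_in_frame`, `cross_normSq_ne_zero`) — no square roots, no dimension count:
* `twistor_comp_twistor`: `(u·(I,J,K))(u'·(I,J,K)) = −⟨u, u'⟩·Id + (u × u')·(I,J,K)` (v1: "`u·v = −(u,v)Id + u × v`");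
  `twistor_comp_self` (the square is `−|u|²·Id`); `coeff_eq_of_twistor_eq` (`I, J, K` are linearly independent, `V_ℝ ≠ 0`);
  **`normSq_eq_of_twistor_eq`** (a common point of the two spans has the same squared norm in both coordinate systems: it
  is `−` the square — v1: "the vectors of length 1 … are precisely those belonging to `S`. So our inner product does not
  depend on the choice of the quaternionic basis").
* **`cross_eq_of_eq`**: two common points `X(u₁) = X'(v₁)`, `X(u₂) = X'(v₂)` give a third common element
  `X(u₁ × u₂) = X'(v₁ × v₂)` (`= ½[I₁, I₂]` computed in either frame — v1: "`u·v = u × v` is again a point in `S` whose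
  corresponding vector is orthogonal to our 2-plane").
* `expand_in_frame`: the polynomial identity `|u₁|²|w|² X(e) = |w|²⟨e,u₁⟩ X(u₁) + |u₁|²⟨e,w⟩ X(w) + ⟨e,t⟩ X(t)`, `w = u₁ × u₂`,
  `t = u₁ × w` (expansion in an orthogonal frame); `cross_normSq_ne_zero`: `|u₁ × u₂|² ≠ 0` when the two unit points are
  non-proportional (`I₁ ≠ ±I₂`; Lagrange's identity).
* **`exists_mem_sphere_of_two_points`**: hence every point of `S(I, J)` is a point of `S(I', J')` (with unit coefficients,
  by `normSq_eq_of_twistor_eq`), and **`sphere_eq_of_two_points`**: `S(I, J) = S(I', J')` as sets of operators — Lemma 1.1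
  (v1: "Thus `S = {au + bv + c u·v | a² + b² + c² = 1}` … uniquely determined by `I₁` and `I₂`").

## What is NOT here

Twistor spheres as subsets of the period domain `Compl ⊂ Gr(2n, 4n)` (the identification `I ↦ (1 − iI)V_ℝ`), their
complex-submanifold structure (Cor. 1.8), and anything about tori: only the operator-level statement of Lemma 1.1.

## References

* [BuskinIzadi2020TwistorLinesTori] N. Buskin, E. Izadi, *Twistor lines in the period domain of complex tori*, Geom.
  Dedicata 213 (2021) 21–47 = arXiv:1806.07831v2, §1.1, Lemma 1.1 (v2 p.5 L36–44, statement; arXiv v1 = corpus chunk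
  p0005 L18–48 = v1 PDF p.3–4, statement AND proof, p.4 L9–30) — read on the v2 PDF text layer and in the corpus text of
  v1; the v1 proof was pointed out by the cell's seat lit-3 (gen 60).
-/

noncomputable section

namespace Literature.Geometry.Hyperkaehler.TwistorSphere

variable {F : Type*} [NormedAddCommGroup F] [NormedSpace ℝ F]

/-- **Quaternion multiplication on the span of a twistor sphere.** For an anticommuting pair of complex structures `I, J`
(`K = IJ`) and coefficient vectors `u = (a, b, c)`, `u' = (a', b', c')`:
`(aI + bJ + cK)(a'I + b'J + c'K) = −⟨u, u'⟩·Id + (u × u')·(I, J, K)` — the imaginary-quaternion product rule.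
[cite: BuskinIzadi2020TwistorLinesTori, v2 §1.1 (p.5 L36–38: "`I` and `J` determine a twistor sphere
`S(I, J) := {aI + bJ + cK | a² + b² + c² = 1}`, where `K = IJ`"); arXiv v1 proof of Lemma 1.1 (chunk p0005 L36–37 = v1 PDF p.4:
"`u·v = −(u,v)Id + u × v`")] -/
theorem twistor_comp_twistor {I J : F →L[ℝ] F} (hI : ∀ v, I (I v) = -v) (hJ : ∀ v, J (J v) = -v)
    (hIJ : ∀ v, J (I v) = -I (J v)) (a b c a' b' c' : ℝ) :
    (a • I + b • J + c • I.comp J).comp (a' • I + b' • J + c' • I.comp J) =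
      -(a * a' + b * b' + c * c') • ContinuousLinearMap.id ℝ F +
        ((b * c' - c * b') • I + (c * a' - a * c') • J + (a * b' - b * a') • I.comp J) := by
  ext v
  simp only [ContinuousLinearMap.coe_comp, Function.comp_apply, _root_.add_apply, _root_.smul_apply,
    ContinuousLinearMap.id_apply, map_add, map_smul, map_neg, hI, hJ, hIJ, smul_add, smul_neg, neg_neg, smul_smul]
  module

/-- The square: `(aI + bJ + cK)² = −(a² + b² + c²)·Id`. [cite: BuskinIzadi2020TwistorLinesTori, v2 §1.1 (p.5 L36–38)] -/
theorem twistor_comp_self {I J : F →L[ℝ] F} (hI : ∀ v, I (I v) = -v) (hJ : ∀ v, J (J v) = -v)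
    (hIJ : ∀ v, J (I v) = -I (J v)) (a b c : ℝ) :
    (a • I + b • J + c • I.comp J).comp (a • I + b • J + c • I.comp J) =
      -(a ^ 2 + b ^ 2 + c ^ 2) • ContinuousLinearMap.id ℝ F := by
  rw [twistor_comp_twistor hI hJ hIJ]
  have h1 : b * c - c * b = 0 := by ring
  have h2 : c * a - a * c = 0 := by ring
  have h3 : a * b - b * a = 0 := by ring
  rw [h1, h2, h3, zero_smul, zero_smul, zero_smul, add_zero, add_zero, add_zero]
  ring_nf

/-- A sum of three real squares vanishes only if each term does. [folklore] -/
private theorem eq_zero_of_sq_add_sq_add_sq_eq_zero {x y z : ℝ} (h : x ^ 2 + y ^ 2 + z ^ 2 = 0) :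
    x = 0 ∧ y = 0 ∧ z = 0 := by
  have hx : x ^ 2 = 0 := by nlinarith [sq_nonneg x, sq_nonneg y, sq_nonneg z]
  have hy : y ^ 2 = 0 := by nlinarith [sq_nonneg x, sq_nonneg y, sq_nonneg z]
  have hz : z ^ 2 = 0 := by nlinarith [sq_nonneg x, sq_nonneg y, sq_nonneg z]
  exact ⟨pow_eq_zero_iff (two_ne_zero) |>.mp hx, pow_eq_zero_iff (two_ne_zero) |>.mp hy,
    pow_eq_zero_iff (two_ne_zero) |>.mp hz⟩

/-- **Coefficients are determined** (`V_ℝ ≠ 0`): if `aI + bJ + cK = a'I + b'J + c'K` then `(a, b, c) = (a', b', c')` —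
`I, J, K` are linearly independent (the difference squares to `−|u − u'|²·Id = 0`).
[cite: BuskinIzadi2020TwistorLinesTori, v2 §1.1 (p.5 L36–44)] -/
theorem coeff_eq_of_twistor_eq [Nontrivial F] {I J : F →L[ℝ] F} (hI : ∀ v, I (I v) = -v) (hJ : ∀ v, J (J v) = -v)
    (hIJ : ∀ v, J (I v) = -I (J v)) {a b c a' b' c' : ℝ}
    (h : a • I + b • J + c • I.comp J = a' • I + b' • J + c' • I.comp J) : a = a' ∧ b = b' ∧ c = c' := by
  have hd : (a - a') • I + (b - b') • J + (c - c') • I.comp J = 0 := by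
    rw [sub_smul, sub_smul, sub_smul, ← sub_eq_zero.mpr h]
    abel
  have hsq := twistor_comp_self hI hJ hIJ (a - a') (b - b') (c - c')
  rw [hd, ContinuousLinearMap.comp_zero] at hsq
  obtain ⟨v₀, hv₀⟩ := exists_ne (0 : F)
  have h0 := congrArg (fun T : F →L[ℝ] F ↦ T v₀) hsq
  simp only [_root_.zero_apply, _root_.smul_apply, ContinuousLinearMap.id_apply] at h0
  have hn : (a - a') ^ 2 + (b - b') ^ 2 + (c - c') ^ 2 = 0 := by
    have := smul_eq_zero.mp h0.symm
    rcases this with h | h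
    · linarith [h]
    · exact absurd h hv₀
  obtain ⟨ha, hb, hc⟩ := eq_zero_of_sq_add_sq_add_sq_eq_zero hn
  exact ⟨sub_eq_zero.mp ha, sub_eq_zero.mp hb, sub_eq_zero.mp hc⟩

/-- **Norms are determined across two spheres** (`V_ℝ ≠ 0`): if a point `aI + bJ + cK` of the span of `S(I, J)` equals a
point `a'I' + b'J' + c'K'` of the span of `S(I', J')`, then `a² + b² + c² = a'² + b'² + c'²` (both are `−` the square).
In particular a common point is a unit vector in both coordinate systems. [cite: BuskinIzadi2020TwistorLinesTori, v2 §1.1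
Lemma 1.1 (p.5 L43–44); arXiv v1 proof (chunk p0005 L38–41: "the vectors of length 1 in `⟨I,J,K⟩_ℝ` are precisely those
belonging to `S`. So our inner product does not depend on the choice of the quaternionic basis")] -/
theorem normSq_eq_of_twistor_eq [Nontrivial F] {I J I' J' : F →L[ℝ] F} (hI : ∀ v, I (I v) = -v)
    (hJ : ∀ v, J (J v) = -v) (hIJ : ∀ v, J (I v) = -I (J v)) (hI' : ∀ v, I' (I' v) = -v) (hJ' : ∀ v, J' (J' v) = -v)
    (hIJ' : ∀ v, J' (I' v) = -I' (J' v)) {a b c a' b' c' : ℝ}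
    (h : a • I + b • J + c • I.comp J = a' • I' + b' • J' + c' • I'.comp J') :
    a ^ 2 + b ^ 2 + c ^ 2 = a' ^ 2 + b' ^ 2 + c' ^ 2 := by
  have h1 := twistor_comp_self hI hJ hIJ a b c
  have h2 := twistor_comp_self hI' hJ' hIJ' a' b' c'
  rw [h, h2] at h1
  obtain ⟨v₀, hv₀⟩ := exists_ne (0 : F)
  have h0 := congrArg (fun T : F →L[ℝ] F ↦ T v₀) h1
  simp only [_root_.smul_apply, ContinuousLinearMap.id_apply] at h0
  have := sub_eq_zero.mpr h0
  rw [← sub_smul, smul_eq_zero] at this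
  rcases this with h3 | h3
  · linarith
  · exact absurd h3 hv₀

/-- **A common point transports cross products**: if two points `u₁·(I, J, K) = v₁·(I', J', K')` and
`u₂·(I, J, K) = v₂·(I', J', K')` of the span of `S(I, J)` lie in the span of `S(I', J')`, then so does
`(u₁ × u₂)·(I, J, K) = (v₁ × v₂)·(I', J', K')` — half the commutator of the two common operators, computed in either frame by
`twistor_comp_twistor`. [cite: BuskinIzadi2020TwistorLinesTori, v2 §1.1 Lemma 1.1 (p.5 L43–44: "Every twistor sphere `S` is
uniquely determined by any pair of non-proportional complex structures `I₁, I₂ ∈ S`"; v2: "an exercise that we leave to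
the reader", p.5 L41–42; arXiv v1 proof, chunk p0005 L42–45: "`u·v = u × v` is again a point in `S` whose corresponding
vector is orthogonal to our 2-plane")] -/
theorem cross_eq_of_eq {I J I' J' : F →L[ℝ] F} (hI : ∀ v, I (I v) = -v) (hJ : ∀ v, J (J v) = -v)
    (hIJ : ∀ v, J (I v) = -I (J v)) (hI' : ∀ v, I' (I' v) = -v) (hJ' : ∀ v, J' (J' v) = -v)
    (hIJ' : ∀ v, J' (I' v) = -I' (J' v)) {a₁ b₁ c₁ a₂ b₂ c₂ p₁ q₁ r₁ p₂ q₂ r₂ : ℝ}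
    (h₁ : a₁ • I + b₁ • J + c₁ • I.comp J = p₁ • I' + q₁ • J' + r₁ • I'.comp J')
    (h₂ : a₂ • I + b₂ • J + c₂ • I.comp J = p₂ • I' + q₂ • J' + r₂ • I'.comp J') :
    (b₁ * c₂ - c₁ * b₂) • I + (c₁ * a₂ - a₁ * c₂) • J + (a₁ * b₂ - b₁ * a₂) • I.comp J =
      (q₁ * r₂ - r₁ * q₂) • I' + (r₁ * p₂ - p₁ * r₂) • J' + (p₁ * q₂ - q₁ * p₂) • I'.comp J' := by
  have E1 : (a₁ • I + b₁ • J + c₁ • I.comp J).comp (a₂ • I + b₂ • J + c₂ • I.comp J) =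
      (p₁ • I' + q₁ • J' + r₁ • I'.comp J').comp (p₂ • I' + q₂ • J' + r₂ • I'.comp J') := by rw [h₁, h₂]
  have E2 : (a₂ • I + b₂ • J + c₂ • I.comp J).comp (a₁ • I + b₁ • J + c₁ • I.comp J) =
      (p₂ • I' + q₂ • J' + r₂ • I'.comp J').comp (p₁ • I' + q₁ • J' + r₁ • I'.comp J') := by rw [h₁, h₂]
  rw [twistor_comp_twistor hI hJ hIJ, twistor_comp_twistor hI' hJ' hIJ'] at E1 E2
  linear_combination (norm := module) (1 / 2 : ℝ) • E1 - (1 / 2 : ℝ) • E2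

/-- **Expansion of any point in the frame `(u₁, w, u₁ × w)`, `w = u₁ × u₂`** — a polynomial identity in the span of
`S(I, J)` (no hypothesis on the coefficients): `|u₁|²|w|²·X(e) = |w|²⟨e, u₁⟩·X(u₁) + |u₁|²⟨e, w⟩·X(w) + ⟨e, t⟩·X(t)` with
`t = u₁ × w`, where `X(u) = u·(I, J, K)`; for `|u₁| = 1` and `w ≠ 0` it expresses every `X(e)` through `X(u₁)`, `X(w)`,
`X(t)` (an orthogonal frame with `|t| = |w|`; this replaces the orthonormal `u, v` of the v1 proof).
[cite: BuskinIzadi2020TwistorLinesTori, v2 §1.1 Lemma 1.1 (p.5 L43–44); arXiv v1 proof (chunk p0005 L46–47: "Thus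
`S = {au + bv + c u·v | a² + b² + c² = 1}`")] -/
theorem expand_in_frame (I J : F →L[ℝ] F) (a₁ b₁ c₁ a₂ b₂ c₂ a b c : ℝ) {w₁ w₂ w₃ t₁ t₂ t₃ : ℝ}
    (hw₁ : w₁ = b₁ * c₂ - c₁ * b₂) (hw₂ : w₂ = c₁ * a₂ - a₁ * c₂) (hw₃ : w₃ = a₁ * b₂ - b₁ * a₂)
    (ht₁ : t₁ = b₁ * w₃ - c₁ * w₂) (ht₂ : t₂ = c₁ * w₁ - a₁ * w₃) (ht₃ : t₃ = a₁ * w₂ - b₁ * w₁) :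
    ((a₁ ^ 2 + b₁ ^ 2 + c₁ ^ 2) * (w₁ ^ 2 + w₂ ^ 2 + w₃ ^ 2)) • (a • I + b • J + c • I.comp J) =
      ((w₁ ^ 2 + w₂ ^ 2 + w₃ ^ 2) * (a * a₁ + b * b₁ + c * c₁)) • (a₁ • I + b₁ • J + c₁ • I.comp J) +
        ((a₁ ^ 2 + b₁ ^ 2 + c₁ ^ 2) * (a * w₁ + b * w₂ + c * w₃)) • (w₁ • I + w₂ • J + w₃ • I.comp J) +
          (a * t₁ + b * t₂ + c * t₃) • (t₁ • I + t₂ • J + t₃ • I.comp J) := by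
  subst ht₁ ht₂ ht₃
  subst hw₁ hw₂ hw₃
  module

/-- `w = u₁ × u₂ ≠ 0` for two non-proportional unit vectors: if `u₁·(I, J, K) ≠ ±u₂·(I, J, K)` (`|u₁| = |u₂| = 1`) then
`|u₁ × u₂|² ≠ 0` (Lagrange: `|u₁ × u₂|² = |u₁|²|u₂|² − ⟨u₁, u₂⟩²`, and `⟨u₁, u₂⟩ = ±1` forces `u₂ = ±u₁`).
[cite: BuskinIzadi2020TwistorLinesTori, v2 §1.1 Lemma 1.1 (p.5 L43–44: "non-proportional complex structures `I₁, I₂ ∈ S`")] -/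
theorem cross_normSq_ne_zero (I J : F →L[ℝ] F) {a₁ b₁ c₁ a₂ b₂ c₂ : ℝ} (hu₁ : a₁ ^ 2 + b₁ ^ 2 + c₁ ^ 2 = 1)
    (hu₂ : a₂ ^ 2 + b₂ ^ 2 + c₂ ^ 2 = 1)
    (hne : a₁ • I + b₁ • J + c₁ • I.comp J ≠ a₂ • I + b₂ • J + c₂ • I.comp J)
    (hne' : a₁ • I + b₁ • J + c₁ • I.comp J ≠ -(a₂ • I + b₂ • J + c₂ • I.comp J)) :
    (b₁ * c₂ - c₁ * b₂) ^ 2 + (c₁ * a₂ - a₁ * c₂) ^ 2 + (a₁ * b₂ - b₁ * a₂) ^ 2 ≠ 0 := by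
  intro hW
  -- Lagrange's identity: `|u₁ × u₂|² = |u₁|²|u₂|² − ⟨u₁, u₂⟩²`, so `⟨u₁, u₂⟩² = 1`
  have hL : (a₁ * a₂ + b₁ * b₂ + c₁ * c₂) ^ 2 = 1 := by
    linear_combination (a₂ ^ 2 + b₂ ^ 2 + c₂ ^ 2) * hu₁ + hu₂ - hW
  have hsq : (a₁ * a₂ + b₁ * b₂ + c₁ * c₂ - 1) * (a₁ * a₂ + b₁ * b₂ + c₁ * c₂ + 1) = 0 := by
    linear_combination hL
  rcases mul_eq_zero.mp hsq with h | h
  · -- `⟨u₁, u₂⟩ = 1`: `|u₁ − u₂|² = 0`, `u₁ = u₂`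
    have h0 : (a₁ - a₂) ^ 2 + (b₁ - b₂) ^ 2 + (c₁ - c₂) ^ 2 = 0 := by linear_combination hu₁ + hu₂ - 2 * h
    obtain ⟨ha, hb, hc⟩ := eq_zero_of_sq_add_sq_add_sq_eq_zero h0
    exact hne (by rw [sub_eq_zero.mp ha, sub_eq_zero.mp hb, sub_eq_zero.mp hc])
  · -- `⟨u₁, u₂⟩ = −1`: `|u₁ + u₂|² = 0`, `u₁ = −u₂`
    have h0 : (a₁ + a₂) ^ 2 + (b₁ + b₂) ^ 2 + (c₁ + c₂) ^ 2 = 0 := by linear_combination hu₁ + hu₂ + 2 * h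
    obtain ⟨ha, hb, hc⟩ := eq_zero_of_sq_add_sq_add_sq_eq_zero h0
    refine hne' ?_
    rw [eq_neg_of_add_eq_zero_left ha, eq_neg_of_add_eq_zero_left hb, eq_neg_of_add_eq_zero_left hc]
    module

/-- **Lemma 1.1 (Buskin–Izadi), inclusion form: a twistor sphere through two non-proportional points of another twistor
sphere contains it.** Let `(I, J)` and `(I', J')` be anticommuting pairs of complex structures on `V_ℝ ≠ 0`, `K = IJ`,
`K' = I'J'`, and let two points `I₁ = u₁·(I, J, K)`, `I₂ = u₂·(I, J, K)` of the sphere `S(I, J)` (`|u₁| = |u₂| = 1`) with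
`I₁ ≠ ±I₂` lie in the span of `S(I', J')`. Then EVERY point `aI + bJ + cK` (`a² + b² + c² = 1`) of `S(I, J)` is a point
`a'I' + b'J' + c'K'` (`a'² + b'² + c'² = 1`) of `S(I', J')`: the spans agree, being generated by `I₁`, `I₂` and `½[I₁, I₂]`
(`cross_eq_of_eq`, `expand_in_frame`), and unit norm transfers (`normSq_eq_of_twistor_eq`). "Every twistor sphere `S` is uniquely
determined by any pair of non-proportional complex structures `I₁, I₂ ∈ S`." [cite: BuskinIzadi2020TwistorLinesTori, v2 §1.1
Lemma 1.1 (p.5 L43–44; v2 "whose proof is an exercise that we leave to the reader", L41–42; arXiv v1 prints the proof,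
chunk p0005 L31–48 = v1 PDF p.4 L9–30)] -/
theorem exists_mem_sphere_of_two_points [Nontrivial F] {I J I' J' : F →L[ℝ] F} (hI : ∀ v, I (I v) = -v)
    (hJ : ∀ v, J (J v) = -v) (hIJ : ∀ v, J (I v) = -I (J v)) (hI' : ∀ v, I' (I' v) = -v) (hJ' : ∀ v, J' (J' v) = -v)
    (hIJ' : ∀ v, J' (I' v) = -I' (J' v)) {a₁ b₁ c₁ a₂ b₂ c₂ p₁ q₁ r₁ p₂ q₂ r₂ : ℝ}
    (hu₁ : a₁ ^ 2 + b₁ ^ 2 + c₁ ^ 2 = 1) (hu₂ : a₂ ^ 2 + b₂ ^ 2 + c₂ ^ 2 = 1)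
    (h₁ : a₁ • I + b₁ • J + c₁ • I.comp J = p₁ • I' + q₁ • J' + r₁ • I'.comp J')
    (h₂ : a₂ • I + b₂ • J + c₂ • I.comp J = p₂ • I' + q₂ • J' + r₂ • I'.comp J')
    (hne : a₁ • I + b₁ • J + c₁ • I.comp J ≠ a₂ • I + b₂ • J + c₂ • I.comp J)
    (hne' : a₁ • I + b₁ • J + c₁ • I.comp J ≠ -(a₂ • I + b₂ • J + c₂ • I.comp J)) {a b c : ℝ}
    (habc : a ^ 2 + b ^ 2 + c ^ 2 = 1) :
    ∃ a' b' c' : ℝ, a' ^ 2 + b' ^ 2 + c' ^ 2 = 1 ∧ a • I + b • J + c • I.comp J = a' • I' + b' • J' + c' • I'.comp J' := by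
  -- the frame `u₁, w = u₁ × u₂, t = u₁ × w` and its image `v₁, w' = v₁ × v₂, t' = v₁ × w'`
  obtain ⟨w₁, hw₁⟩ : ∃ w₁ : ℝ, w₁ = b₁ * c₂ - c₁ * b₂ := ⟨_, rfl⟩
  obtain ⟨w₂, hw₂⟩ : ∃ w₂ : ℝ, w₂ = c₁ * a₂ - a₁ * c₂ := ⟨_, rfl⟩
  obtain ⟨w₃, hw₃⟩ : ∃ w₃ : ℝ, w₃ = a₁ * b₂ - b₁ * a₂ := ⟨_, rfl⟩
  obtain ⟨t₁, ht₁⟩ : ∃ t₁ : ℝ, t₁ = b₁ * w₃ - c₁ * w₂ := ⟨_, rfl⟩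
  obtain ⟨t₂, ht₂⟩ : ∃ t₂ : ℝ, t₂ = c₁ * w₁ - a₁ * w₃ := ⟨_, rfl⟩
  obtain ⟨t₃, ht₃⟩ : ∃ t₃ : ℝ, t₃ = a₁ * w₂ - b₁ * w₁ := ⟨_, rfl⟩
  obtain ⟨w₁', hw₁'⟩ : ∃ w₁' : ℝ, w₁' = q₁ * r₂ - r₁ * q₂ := ⟨_, rfl⟩
  obtain ⟨w₂', hw₂'⟩ : ∃ w₂' : ℝ, w₂' = r₁ * p₂ - p₁ * r₂ := ⟨_, rfl⟩
  obtain ⟨w₃', hw₃'⟩ : ∃ w₃' : ℝ, w₃' = p₁ * q₂ - q₁ * p₂ := ⟨_, rfl⟩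
  obtain ⟨t₁', ht₁'⟩ : ∃ t₁' : ℝ, t₁' = q₁ * w₃' - r₁ * w₂' := ⟨_, rfl⟩
  obtain ⟨t₂', ht₂'⟩ : ∃ t₂' : ℝ, t₂' = r₁ * w₁' - p₁ * w₃' := ⟨_, rfl⟩
  obtain ⟨t₃', ht₃'⟩ : ∃ t₃' : ℝ, t₃' = p₁ * w₂' - q₁ * w₁' := ⟨_, rfl⟩
  -- `X(w) = X'(w')` and `X(t) = X'(t')`
  have hC : w₁ • I + w₂ • J + w₃ • I.comp J = w₁' • I' + w₂' • J' + w₃' • I'.comp J' := by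
    subst hw₁ hw₂ hw₃ hw₁' hw₂' hw₃'
    exact cross_eq_of_eq hI hJ hIJ hI' hJ' hIJ' h₁ h₂
  have hD : t₁ • I + t₂ • J + t₃ • I.comp J = t₁' • I' + t₂' • J' + t₃' • I'.comp J' := by
    subst ht₁ ht₂ ht₃ ht₁' ht₂' ht₃'
    exact cross_eq_of_eq hI hJ hIJ hI' hJ' hIJ' h₁ hC
  -- `W = |w|² ≠ 0`
  have hW : w₁ ^ 2 + w₂ ^ 2 + w₃ ^ 2 ≠ 0 := by
    subst hw₁ hw₂ hw₃
    exact cross_normSq_ne_zero I J hu₁ hu₂ hne hne'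
  -- expand `X(e)` in the frame and transport
  have hE := expand_in_frame I J a₁ b₁ c₁ a₂ b₂ c₂ a b c hw₁ hw₂ hw₃ ht₁ ht₂ ht₃
  rw [hu₁, one_mul, one_mul, h₁, hC, hD] at hE
  have hE' := congrArg (fun T : F →L[ℝ] F ↦ (w₁ ^ 2 + w₂ ^ 2 + w₃ ^ 2)⁻¹ • T) hE
  simp only [smul_smul, inv_mul_cancel₀ hW, one_smul] at hE'
  obtain ⟨a', ha'⟩ : ∃ a' : ℝ, a' = (w₁ ^ 2 + w₂ ^ 2 + w₃ ^ 2)⁻¹ *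
      ((w₁ ^ 2 + w₂ ^ 2 + w₃ ^ 2) * (a * a₁ + b * b₁ + c * c₁) * p₁ + (a * w₁ + b * w₂ + c * w₃) * w₁' +
        (a * t₁ + b * t₂ + c * t₃) * t₁') := ⟨_, rfl⟩
  obtain ⟨b', hb'⟩ : ∃ b' : ℝ, b' = (w₁ ^ 2 + w₂ ^ 2 + w₃ ^ 2)⁻¹ *
      ((w₁ ^ 2 + w₂ ^ 2 + w₃ ^ 2) * (a * a₁ + b * b₁ + c * c₁) * q₁ + (a * w₁ + b * w₂ + c * w₃) * w₂' +
        (a * t₁ + b * t₂ + c * t₃) * t₂') := ⟨_, rfl⟩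
  obtain ⟨c', hc'⟩ : ∃ c' : ℝ, c' = (w₁ ^ 2 + w₂ ^ 2 + w₃ ^ 2)⁻¹ *
      ((w₁ ^ 2 + w₂ ^ 2 + w₃ ^ 2) * (a * a₁ + b * b₁ + c * c₁) * r₁ + (a * w₁ + b * w₂ + c * w₃) * w₃' +
        (a * t₁ + b * t₂ + c * t₃) * t₃') := ⟨_, rfl⟩
  have hfinal : a • I + b • J + c • I.comp J = a' • I' + b' • J' + c' • I'.comp J' := by
    rw [hE', ha', hb', hc']
    module
  refine ⟨a', b', c', ?_, hfinal⟩
  have hn := normSq_eq_of_twistor_eq hI hJ hIJ hI' hJ' hIJ' hfinal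
  rw [habc] at hn
  exact hn.symm

/-- **Lemma 1.1 (Buskin–Izadi): "Every twistor sphere `S` is uniquely determined by any pair of non-proportional complex
structures `I₁, I₂ ∈ S`."** If the twistor spheres `S(I, J) = {aI + bJ + cK | a² + b² + c² = 1}` and `S(I', J')` of two
anticommuting pairs of complex structures on `V_ℝ ≠ 0` have two common points `I₁ ≠ ±I₂`, they are EQUAL (as sets of
operators). [cite: BuskinIzadi2020TwistorLinesTori, v2 §1.1 Lemma 1.1 (p.5 L43–44), with p.5 L39–42: "for two complex structures
`I₁, I₂`, not necessarily anticommuting, such that `I₁ ≠ ±I₂`, and such that they are contained in the same twistor sphere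
`S`, we will also denote this sphere by `S(I₁, I₂)`. Our notation is justifed by the following lemma, whose proof is an
exercise that we leave to the reader."] -/
theorem sphere_eq_of_two_points [Nontrivial F] {I J I' J' : F →L[ℝ] F} (hI : ∀ v, I (I v) = -v)
    (hJ : ∀ v, J (J v) = -v) (hIJ : ∀ v, J (I v) = -I (J v)) (hI' : ∀ v, I' (I' v) = -v) (hJ' : ∀ v, J' (J' v) = -v)
    (hIJ' : ∀ v, J' (I' v) = -I' (J' v)) {a₁ b₁ c₁ a₂ b₂ c₂ p₁ q₁ r₁ p₂ q₂ r₂ : ℝ}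
    (hu₁ : a₁ ^ 2 + b₁ ^ 2 + c₁ ^ 2 = 1) (hu₂ : a₂ ^ 2 + b₂ ^ 2 + c₂ ^ 2 = 1)
    (h₁ : a₁ • I + b₁ • J + c₁ • I.comp J = p₁ • I' + q₁ • J' + r₁ • I'.comp J')
    (h₂ : a₂ • I + b₂ • J + c₂ • I.comp J = p₂ • I' + q₂ • J' + r₂ • I'.comp J')
    (hne : a₁ • I + b₁ • J + c₁ • I.comp J ≠ a₂ • I + b₂ • J + c₂ • I.comp J)
    (hne' : a₁ • I + b₁ • J + c₁ • I.comp J ≠ -(a₂ • I + b₂ • J + c₂ • I.comp J)) :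
    {T : F →L[ℝ] F | ∃ a b c : ℝ, a ^ 2 + b ^ 2 + c ^ 2 = 1 ∧ T = a • I + b • J + c • I.comp J} =
      {T : F →L[ℝ] F | ∃ a b c : ℝ, a ^ 2 + b ^ 2 + c ^ 2 = 1 ∧ T = a • I' + b • J' + c • I'.comp J'} := by
  -- the two common points are unit vectors in the primed frame too
  have hv₁ : p₁ ^ 2 + q₁ ^ 2 + r₁ ^ 2 = 1 := (normSq_eq_of_twistor_eq hI hJ hIJ hI' hJ' hIJ' h₁).symm.trans hu₁
  have hv₂ : p₂ ^ 2 + q₂ ^ 2 + r₂ ^ 2 = 1 := (normSq_eq_of_twistor_eq hI hJ hIJ hI' hJ' hIJ' h₂).symm.trans hu₂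
  ext T
  simp only [Set.mem_setOf_eq]
  constructor
  · rintro ⟨a, b, c, habc, rfl⟩
    exact exists_mem_sphere_of_two_points hI hJ hIJ hI' hJ' hIJ' hu₁ hu₂ h₁ h₂ hne hne' habc
  · rintro ⟨a, b, c, habc, rfl⟩
    have hne₂ : p₁ • I' + q₁ • J' + r₁ • I'.comp J' ≠ p₂ • I' + q₂ • J' + r₂ • I'.comp J' := by rwa [← h₁, ← h₂]
    have hne₂' : p₁ • I' + q₁ • J' + r₁ • I'.comp J' ≠ -(p₂ • I' + q₂ • J' + r₂ • I'.comp J') := by rwa [← h₁, ← h₂]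
    exact exists_mem_sphere_of_two_points hI' hJ' hIJ' hI hJ hIJ hv₁ hv₂ h₁.symm h₂.symm hne₂ hne₂' habc

end Literature.Geometry.Hyperkaehler.TwistorSphere
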